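import Literature.MathematicalPhysics.QuantumFieldTheory.Balaban1983to89.B9Thm31GpAgmonDecayZd
import Literature.MathematicalPhysics.QuantumFieldTheory.Balaban1983to89.B9Eq342GradientRowComparisonMassUniform
import Literature.MathematicalPhysics.QuantumFieldTheory.Balaban1983to89.B9Thm31FriedrichsCoerciveZd

/-!
# `Balaban1983to89.B9Thm31GpAgmonDecayCoarseZd` — [Balaban1985BackgroundPropagators] Thm 3.1 (3.42) p. 397 («uniformly in U, Ω_j») FOR THE GENUINE
# `G′(U₀) = (Ω₀Δ′_a(U₀)Ω₀)⁻¹` AT THE `ℤᵈ` CARRIER: THE COARSE-SCALE AGMON WEIGHT `ρ = L^{−m}|· − y|_∞` AND THE WINDOW SOLVED WITH AN EXPLICIT RATE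
# `κ₀ = min{1, θc₀∕(6dB + 15A)}` — from the DISPLAYED level-weighted coercivity `c₀Σ_zM_z|Φ z|²_τ ≤ ⟨Φ, Δ′_aΦ⟩_τ` and two SCALING inequalities on the
# displayed data (`(Lᵐη)⁻² ≤ B·M`, `Σ_j𝟙[yʲ(z)∈Λ_j]a_j(Lᵈ)^{−j} ≤ A·M`), for every `0 ≤ κ ≤ κ₀`:
# ★★★ `|(G′(U₀)δ_y w)(x)|_τ ≤ e^{−κL^{−m}|x−y|_∞}·|w|_τ∕((1−θ)c₀√(M_xM_y)) ≤ (B∕((1−θ)c₀))·(Lᵐη)²·e^{−κL^{−m}|x−y|_∞}·|w|_τ` — NO `η`, NO `|Ω₀|`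

statement-level skeleton of published theorems with citation tags; proofs where landed; nothing here is a claim about the
Yang–Mills mass gap

`[Balaban1985BackgroundPropagators]` ("B9", CMP **99** (1985) 389–434) Thm 3.1 p. 397: *«|(G′(U)f)(x)| ≤ O(1)(Lʲη)²e^{−δ₀d(y,y′)}|f| (3.42) … uniformly in U, Ω_j»*;
(3.24) p. 394; Thm 3.11 p. 416.  Print: random walk of Sects. B–C, with the multi-scale distance `d(y,y′)`.  THIS FILE closes this seat's Agmon road (g5 FILES 1–3:
`B9Eq346AgmonReadingZd`, `B9Eq323ConjugatedLaplacianFormZd`, `B9Eq324ConjugatedFormZd`, `B9Thm31GpAgmonDecayZd`) with a CONCRETE admissible weight and an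
EXPLICIT rate: the single-scale weight at the COARSEST level `m` of the member, `ρ(x) = L^{−m}|x − y|_∞` — bond increments `≤ L^{−m}` (so the gradient defect
`6dη⁻²(cosh(κL^{−m}) − 1) ≤ 6dκ²(Lᵐη)⁻²`), oscillation `< 1` on every block of level `j ≤ m` (two sites with the same `j`-fold block index are within `Lʲ − 1`,
this seat g4's `linfDist_le_of_blockMap_iterate_eq`) — for which FILE 3's window `≤ θc₀M` is implied by `κ ≤ κ₀ := min{1, θc₀∕(6dB + 15A)}` once the displayed
masses dominate the two scales present: `(Lᵐη)⁻² ≤ B·M(z)` and `Σ_{j≤m}𝟙[yʲ(z)∈Λ_j]a_j(Lᵈ)^{−j} ≤ A·M(z)` (print: level masses `(Lʲη)⁻²` with `j ≤ m`, and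
`a_j(Lʲη)^{d−2}` with `a_j ≤ a` in the unweighted currency — `B = 1`, `A = a∕m₀`).  HONEST: the rate `κ₀L^{−m}` per fine site is print's `δ₀` AT THE COARSEST SCALE
`Lᵐη`; print's multi-scale `d(y,y′)` (faster decay across the finer shells `Λ_j`, `j < m`) is NOT reached by a single-scale weight.

CITATION HEADER (lean-in-tree rule).  Cell `pub-ymgap` (YM Track A, HUMAN RULING D-0062 ∕ D-0149 width push), DAG node N06 = [B9], width seat
`pub-ymgap-dag-n06-w2` (g5), CLAIM-4.  Inputs BY NAME: FILE 3's `fnorm_GpZd_single_le_exp_of_levelCoercive`, g4's `linfDist_le_of_blockMap_iterate_eq`, n06-w4 g4's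
`formE_deltaPrimeADom_coercive_cubeMember_uniform` (the Friedrichs constant at a cube member), the engine's
`abs_dist_sub_dist_le`, `LatticeNorms.linfDist_comm ∕ _triangle ∕ _le_iff`, w4 g2's `blockMapIter`, and the pub-balaban NE9 lineage's `cosh_mul_sub_one_le`
(`B9Eq342GradientRowComparisonMassUniform`, [folklore] calculus, Mathlib-only imports).  Nothing restated.

WHAT IS PROVED (kernel, 0 sorry, 0 def; no `instance`, no `notation`).
* §1 numerics: `cosh_one_sub_one_le_one`, `cosh_sub_one_le_sq` (`cosh t − 1 ≤ t²`, `0 ≤ t ≤ 1`), `exp_two_le` (`e² ≤ 15∕2`), `exp_two_mul_sub_one_le`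
  (`e^{2κ} − 1 ≤ 15κ`, `0 ≤ κ ≤ 1`).
* §2 geometry of `ρ = L^{−m}|· − y|_∞`: `blockMapIter_eq_iterate`, `abs_linfDist_sub_linfDist_step_le`, `abs_rho_step_le` (`≤ L^{−m}`),
  `abs_rho_sub_rho_le_of_blockMapIter_eq` (`≤ L^{−m}(Lʲ − 1) ≤ 1` on a common `j`-block, `j ≤ m`).
* §3 ★★ `window_of_scaling` — `0 ≤ κ ≤ 1`, `κ·(6dB + 15A) ≤ θc₀`, the two scaling inequalities, `a ≥ 0`, `M ≥ 0` ⟹ FILE 3's window at `ℓ = L^{−m}`, `σ ≡ 1`.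
* §4 ★★★ `fnorm_GpZd_single_le_exp_coarse` — THE (3.42)₀ SHAPE WITH EXPLICIT UNIFORM CONSTANTS: `|(G′(U₀)δ_y w)(x)|_τ ≤ e^{−κL^{−m}|x−y|_∞}|w|_τ∕((1−θ)c₀√(M_xM_y))`
  for every `0 ≤ κ ≤ min{1, θc₀∕(6dB + 15A)}`; ★★★ `fnorm_GpZd_single_le_exp_coarse_amplitude` — with `√(M_xM_y) ≥ (Lᵐη)⁻²∕B`:
  `≤ (B∕((1−θ)c₀))·(Lᵐη)²·e^{−κL^{−m}|x−y|_∞}·|w|_τ`.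
* §5 ★★ `fnorm_GpZd_single_le_exp_coarse_cubeMember` — NON-VACUITY (A6): at a cube member of [B8] (1.131) (`ηLᵏ ≤ 1`), EVERY unitary `U₀` with unitary averaged
  transporters: n06-w4 g4's member-uniform Friedrichs constant `c₀ = (M_c + 4ρ)⁻²` discharges `hco` with the flat mass `M ≡ 1`, and the bound holds with
  `B = η⁻²L^{−2m}`, `A = Σ_{j≤m}a_j(Lᵈ)^{−j}` — no displayed coercivity left (uniform in `η` exactly when these two numbers are; the level-weighted `hco` of §4 is what
  dominates print's multi-level penalty weights).

HONEST SCOPE.  (i) A REDUCTION with explicit constants: `hco` (level-weighted coercivity) is DISPLAYED (n06-w4's lane: flat `U₀ = 1` edition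
`B9Thm31FlatPoincareCoerciveZd` in flight; the curved (3.35) class to follow); the two scaling inequalities are DISPLAYED (dischargeable from the member's level data
by the geometry owners).  (ii) Single-scale rate only (coarsest level); the sup∕Hölder entries (3.43)–(3.45), derivatives, (3.47) untouched.  (iii) GIVEN the displayed
data with print's scaling, no constant here depends on `η`, `|Ω₀|`, `U₀` — that, and only that, is the uniformity claimed.  Count-neutral; N05 ∕ N06 NOT discharged;
K1⁹ `stmt-QuantumFields-27364` NOT closed; one finite `𝕋⁴` programme at fixed `ε`, Bałaban as printed; R4 closes only the conditional finite-`𝕋⁴` rung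
`BalabanLadder.UV` — nothing continuum ∕ ℝ⁴ ∕ OS ∕ mass gap ∕ Clay.  Unit `pub-ymgap-dag-n06-w2` (g5), 2026-08-28.
-/

noncomputable section

open scoped BigOperators

namespace Literature.MathematicalPhysics.QuantumFieldTheory.Balaban1983to89.B9Thm31GpAgmonDecayCoarseZd

open Literature.MathematicalPhysics.QuantumLattice (blockMap)
open B7Prop1Explicit (e)
open B7Prop2Explicit (unitaryUnits)
open B8Eq119TwistedAxial (bgT)
open B9Eq321LandauProjectionZd (suppSub formE formE_apply)
open B9Eq324DeltaPrimeAZd (single restrictSite deltaPrimeADom GpZd)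
open B9Eq325QprimeSingleSiteZd (blockMapIter blockMapIter_zero blockMapIter_succ)
open B9Eq342CombesThomasFormZd
open B9Thm31GpDecayOfCoerciveZd (linfDist_le_of_blockMap_iterate_eq)
open B9Thm31GpAgmonDecayZd (fnorm_GpZd_single_le_exp_of_levelCoercive)
open B9Eq342GradientRowComparisonMassUniform (cosh_mul_sub_one_le)
open B8Eq131CubesAdmissible (cubeFam)
open B8LeafModelZd (ZdIdx)
open B9Thm311PosDefOpenZd (cubeMember_Ω0_finite)
open B9Thm31FriedrichsCoerciveZd (formE_deltaPrimeADom_coercive_cubeMember_uniform)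
open LatticeNorms (linfDist)

export B7Prop1Explicit (Site)

variable {d : ℕ} {𝔸 : Type*} [CStarAlgebra 𝔸]

/-! ## §1  Numerics: `cosh t − 1 ≤ t²` and `e^{2κ} − 1 ≤ 15κ` on `[0, 1]` -/

section Numerics

/-- `cosh 1 − 1 ≤ 1` (`e < 2.72`, `e⁻¹ ≤ 1`). [folklore] [cite: Balaban1985BackgroundPropagators, (3.42) p.397 (bookkeeping)] -/
theorem cosh_one_sub_one_le_one : Real.cosh 1 - 1 ≤ 1 := by
  rw [Real.cosh_eq]
  have h1 : Real.exp 1 < 2.7182818286 := Real.exp_one_lt_d9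
  have h2 : Real.exp (-1) ≤ 1 := by rw [Real.exp_le_one_iff]; norm_num
  linarith

/-- `cosh t − 1 ≤ t²` for `0 ≤ t ≤ 1` (star-shape `cosh(λ·1) − 1 ≤ λ²(cosh 1 − 1)`). [folklore] [cite: Balaban1985BackgroundPropagators, (3.42) p.397 (bookkeeping)] -/
theorem cosh_sub_one_le_sq {t : ℝ} (h0 : 0 ≤ t) (h1 : t ≤ 1) : Real.cosh t - 1 ≤ t ^ 2 := by
  have h := cosh_mul_sub_one_le h0 h1 zero_le_one
  rw [mul_one] at h
  have := cosh_one_sub_one_le_one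
  nlinarith [sq_nonneg t]

/-- `e² ≤ 15∕2`. [folklore] [cite: Balaban1985BackgroundPropagators, (3.42) p.397 (bookkeeping)] -/
theorem exp_two_le : Real.exp 2 ≤ 15 / 2 := by
  have h1 : Real.exp 1 < 2.7182818286 := Real.exp_one_lt_d9
  have h2 : Real.exp 2 = Real.exp 1 * Real.exp 1 := by rw [← Real.exp_add]; norm_num
  rw [h2]
  nlinarith [Real.exp_pos (1 : ℝ)]

/-- `e^{2κ} − 1 ≤ 15κ` for `0 ≤ κ ≤ 1`. [folklore] [cite: Balaban1985BackgroundPropagators, (3.42) p.397 (bookkeeping)] -/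
theorem exp_two_mul_sub_one_le {κ : ℝ} (h0 : 0 ≤ κ) (h1 : κ ≤ 1) : Real.exp (2 * κ) - 1 ≤ 15 * κ := by
  -- `eˣ − 1 ≤ x·eˣ` (the tree's `AreaLaw.exp_sub_one_le_mul_exp`, re-derived inline from `1 − x ≤ e^{−x}`)
  have h : Real.exp (2 * κ) - 1 ≤ 2 * κ * Real.exp (2 * κ) := by
    have h' := Real.add_one_le_exp (-(2 * κ))
    have hprod : Real.exp (2 * κ) * Real.exp (-(2 * κ)) = 1 := by rw [← Real.exp_add, add_neg_cancel, Real.exp_zero]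
    nlinarith [Real.exp_pos (2 * κ), Real.exp_pos (-(2 * κ))]
  have hle : Real.exp (2 * κ) ≤ Real.exp 2 := Real.exp_le_exp.2 (by linarith)
  have h2 := exp_two_le
  nlinarith [Real.exp_pos (2 * κ)]

end Numerics

/-! ## §2  Geometry of the coarse-scale weight `ρ = L^{−m}|· − y|_∞` -/

section Geometry

omit [CStarAlgebra 𝔸] in
/-- the two iterate spellings agree: `blockMapIter L j x = (blockMap L)^[j] x`. [cite: Balaban1985BackgroundPropagators, (3.19) p.393 (bookkeeping)] -/
theorem blockMapIter_eq_iterate (L j : ℕ) (x : Site d) : blockMapIter L j x = (blockMap L)^[j] x := by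
  induction j with
  | zero => rfl
  | succ j ih => rw [blockMapIter_succ, ih, Function.iterate_succ_apply']

omit [CStarAlgebra 𝔸] in
/-- `||z + e_μ − y|_∞ − |z − y|_∞| ≤ 1`. [cite: Balaban1985BackgroundPropagators, (3.42) p.397 (bookkeeping)] -/
theorem abs_linfDist_sub_linfDist_step_le (y z : Site d) (μ : Fin d) :
    |((linfDist (z + e μ) y : ℕ) : ℝ) - ((linfDist z y : ℕ) : ℝ)| ≤ 1 := by
  have h := abs_dist_sub_dist_le (dist := fun a b : Site d => ((linfDist a b : ℕ) : ℝ)) (fun a b => by rw [LatticeNorms.linfDist_comm])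
    (fun a b c => by exact_mod_cast LatticeNorms.linfDist_triangle a b c) y (z + e μ) z
  refine h.trans ?_
  -- a unit step moves `ℓ∞`-distance at most one (the tree's `B9Eq326DRDsKernelDecayZd.linfDist_add_e_le`, inlined)
  have hstep : linfDist (z + e μ) z ≤ 1 := by
    rw [LatticeNorms.linfDist_le_iff]
    intro i
    simp only [Pi.add_apply, e, Pi.single_apply]
    split_ifs <;> simp
  exact_mod_cast hstep

omit [CStarAlgebra 𝔸] in
/-- **BOND INCREMENTS OF `ρ`**: `|ρ(z+e_μ) − ρ(z)| ≤ L^{−m}` for `ρ = L^{−m}|· − y|_∞`. [cite: Balaban1985BackgroundPropagators, (3.42) p.397; Agmon1982, Thm 1.5 p.19] -/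
theorem abs_rho_step_le (L m : ℕ) (hL : 1 ≤ L) (y z : Site d) (μ : Fin d) :
    |((L : ℝ) ^ m)⁻¹ * ((linfDist (z + e μ) y : ℕ) : ℝ) - ((L : ℝ) ^ m)⁻¹ * ((linfDist z y : ℕ) : ℝ)| ≤ ((L : ℝ) ^ m)⁻¹ := by
  have hLm : 0 < ((L : ℝ) ^ m)⁻¹ := by
    have : (0 : ℝ) < L := by exact_mod_cast hL
    positivity
  rw [← mul_sub, abs_mul, abs_of_pos hLm]
  have h := abs_linfDist_sub_linfDist_step_le (d := d) y z μ
  calc ((L : ℝ) ^ m)⁻¹ * |((linfDist (z + e μ) y : ℕ) : ℝ) - ((linfDist z y : ℕ) : ℝ)| ≤ ((L : ℝ) ^ m)⁻¹ * 1 :=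
        mul_le_mul_of_nonneg_left h hLm.le
    _ = ((L : ℝ) ^ m)⁻¹ := mul_one _

omit [CStarAlgebra 𝔸] in
/-- **OSCILLATION OF `ρ` ON A BLOCK**: two sites with the same `j`-fold block index, `j ≤ m`, have `|ρ(x) − ρ(x′)| ≤ L^{−m}(Lʲ − 1) ≤ 1` (`L ≥ 1`).
[cite: Balaban1985BackgroundPropagators, (3.18)–(3.19) p.393, (3.42) p.397; Balaban1985Averaging, (78) p.30] -/
theorem abs_rho_sub_rho_le_of_blockMapIter_eq (L m : ℕ) (hL : 1 ≤ L) {j : ℕ} (hj : j ≤ m) (y : Site d) {x x' : Site d}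
    (h : blockMapIter L j x = blockMapIter L j x') :
    |((L : ℝ) ^ m)⁻¹ * ((linfDist x y : ℕ) : ℝ) - ((L : ℝ) ^ m)⁻¹ * ((linfDist x' y : ℕ) : ℝ)| ≤ 1 := by
  have hL0 : (0 : ℝ) < L := by exact_mod_cast hL
  have hLm : 0 < ((L : ℝ) ^ m)⁻¹ := by positivity
  rw [← mul_sub, abs_mul, abs_of_pos hLm]
  -- `|x − x′|_∞ + 1 ≤ Lʲ ≤ Lᵐ`
  rw [blockMapIter_eq_iterate, blockMapIter_eq_iterate] at h
  have hblock := linfDist_le_of_blockMap_iterate_eq (d := d) hL j h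
  have hpow : L ^ j ≤ L ^ m := Nat.pow_le_pow_right hL hj
  have hdist : ((linfDist x x' : ℕ) : ℝ) + 1 ≤ (L : ℝ) ^ m := by exact_mod_cast hblock.trans hpow
  -- `||x − y| − |x′ − y|| ≤ |x − x′|`
  have htri := abs_dist_sub_dist_le (dist := fun a b : Site d => ((linfDist a b : ℕ) : ℝ)) (fun a b => by rw [LatticeNorms.linfDist_comm])
    (fun a b c => by exact_mod_cast LatticeNorms.linfDist_triangle a b c) y x x'
  have hle : |((linfDist x y : ℕ) : ℝ) - ((linfDist x' y : ℕ) : ℝ)| ≤ (L : ℝ) ^ m := by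
    refine htri.trans ?_
    show ((linfDist x x' : ℕ) : ℝ) ≤ (L : ℝ) ^ m
    linarith
  calc ((L : ℝ) ^ m)⁻¹ * |((linfDist x y : ℕ) : ℝ) - ((linfDist x' y : ℕ) : ℝ)| ≤ ((L : ℝ) ^ m)⁻¹ * (L : ℝ) ^ m :=
        mul_le_mul_of_nonneg_left hle hLm.le
    _ = 1 := inv_mul_cancel₀ (by positivity)

end Geometry

/-! ## §3  The window solved by scaling -/

section Window

omit [CStarAlgebra 𝔸] in
/-- ★★ **THE WINDOW OF FILE 3 SOLVED BY SCALING.**  `0 ≤ κ ≤ 1`, `κ·(6dB + 15A) ≤ θc₀`, `a ≥ 0`, `M ≥ 0` on `Ω₀`, and the two scaling inequalities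
`η⁻²(Lᵐ)⁻² ≤ B·M(z)`, `Σ_{j≤m}𝟙[yʲ(z)∈Λ_j]a_j(Lᵈ)^{−j} ≤ A·M(z)` on `Ω₀` ⟹ for every `z ∈ Ω₀`
`6dη⁻²(cosh(κ(Lᵐ)⁻¹) − 1) + Σ_{j≤m}𝟙[yʲ(z)∈Λ_j]a_j(e^{2κ·1} − 1)(Lᵈ)^{−j} ≤ θc₀M(z)`.
[cite: Balaban1985BackgroundPropagators, Thm 3.1 (3.42) p.397, (3.24) p.394; Agmon1982, Thm 1.5 p.19] -/
theorem window_of_scaling {L m : ℕ} (hL : 1 ≤ L) {η : ℝ} {a : ℕ → ℝ} (ha : ∀ j, 0 ≤ a j) (Λ : ℕ → Finset (Site d)) {s : Finset (Site d)}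
    {M : Site d → ℝ} (hM0 : ∀ z ∈ s, 0 ≤ M z) {A B c₀ θ κ : ℝ} (hκ0 : 0 ≤ κ) (hκ1 : κ ≤ 1)
    (hκ : κ * (6 * d * B + 15 * A) ≤ θ * c₀)
    (hB : ∀ z ∈ s, (η⁻¹) ^ 2 * (((L : ℝ) ^ m)⁻¹) ^ 2 ≤ B * M z)
    (hA : ∀ z ∈ s, ∑ j ∈ Finset.range (m + 1), (if blockMapIter L j z ∈ Λ j then a j * (((L : ℝ) ^ d)⁻¹) ^ j else 0) ≤ A * M z)
    {z : Site d} (hz : z ∈ s) :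
    6 * d * (η⁻¹) ^ 2 * (Real.cosh (κ * ((L : ℝ) ^ m)⁻¹) - 1) +
      ∑ j ∈ Finset.range (m + 1), (if blockMapIter L j z ∈ Λ j then a j * (Real.exp (2 * κ * (1 : ℝ)) - 1) * (((L : ℝ) ^ d)⁻¹) ^ j else 0) ≤ θ * c₀ * M z := by
  have hL0 : (0 : ℝ) < L := by exact_mod_cast hL
  have hLm1 : 1 ≤ (L : ℝ) ^ m := one_le_pow₀ (by exact_mod_cast hL)
  have hLinv : ((L : ℝ) ^ m)⁻¹ ≤ 1 := inv_le_one_of_one_le₀ hLm1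
  have hLinv0 : 0 ≤ ((L : ℝ) ^ m)⁻¹ := by positivity
  -- the gradient part: `cosh(κL^{−m}) − 1 ≤ κ²(Lᵐ)⁻² ≤ κ·(Lᵐ)⁻²`
  have ht0 : 0 ≤ κ * ((L : ℝ) ^ m)⁻¹ := mul_nonneg hκ0 hLinv0
  have ht1 : κ * ((L : ℝ) ^ m)⁻¹ ≤ 1 := by nlinarith
  have hcosh := cosh_sub_one_le_sq ht0 ht1
  have hgrad : 6 * d * (η⁻¹) ^ 2 * (Real.cosh (κ * ((L : ℝ) ^ m)⁻¹) - 1) ≤ 6 * d * B * κ * M z := by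
    have h1 : (Real.cosh (κ * ((L : ℝ) ^ m)⁻¹) - 1) ≤ κ * (((L : ℝ) ^ m)⁻¹) ^ 2 := by
      refine hcosh.trans ?_
      rw [mul_pow]
      exact mul_le_mul_of_nonneg_right (by nlinarith) (sq_nonneg _)
    have hd0 : (0 : ℝ) ≤ 6 * d * (η⁻¹) ^ 2 := by positivity
    calc 6 * d * (η⁻¹) ^ 2 * (Real.cosh (κ * ((L : ℝ) ^ m)⁻¹) - 1) ≤ 6 * d * (η⁻¹) ^ 2 * (κ * (((L : ℝ) ^ m)⁻¹) ^ 2) :=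
          mul_le_mul_of_nonneg_left h1 hd0
      _ = 6 * d * κ * ((η⁻¹) ^ 2 * (((L : ℝ) ^ m)⁻¹) ^ 2) := by ring
      _ ≤ 6 * d * κ * (B * M z) := mul_le_mul_of_nonneg_left (hB z hz) (by positivity)
      _ = 6 * d * B * κ * M z := by ring
  -- the averaging part: `e^{2κ} − 1 ≤ 15κ`
  have hexp := exp_two_mul_sub_one_le hκ0 hκ1
  have havg : ∑ j ∈ Finset.range (m + 1), (if blockMapIter L j z ∈ Λ j then a j * (Real.exp (2 * κ * (1 : ℝ)) - 1) * (((L : ℝ) ^ d)⁻¹) ^ j else 0) ≤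
      15 * A * κ * M z := by
    have hterm : ∀ j ∈ Finset.range (m + 1),
        (if blockMapIter L j z ∈ Λ j then a j * (Real.exp (2 * κ * (1 : ℝ)) - 1) * (((L : ℝ) ^ d)⁻¹) ^ j else 0) ≤
          15 * κ * (if blockMapIter L j z ∈ Λ j then a j * (((L : ℝ) ^ d)⁻¹) ^ j else 0) := by
      intro j _
      by_cases hzj : blockMapIter L j z ∈ Λ j
      · simp only [hzj, if_true, mul_one]
        have hw : 0 ≤ a j * (((L : ℝ) ^ d)⁻¹) ^ j := mul_nonneg (ha j) (by positivity)
        calc a j * (Real.exp (2 * κ) - 1) * (((L : ℝ) ^ d)⁻¹) ^ j = (Real.exp (2 * κ) - 1) * (a j * (((L : ℝ) ^ d)⁻¹) ^ j) := by ring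
          _ ≤ 15 * κ * (a j * (((L : ℝ) ^ d)⁻¹) ^ j) := mul_le_mul_of_nonneg_right hexp hw
      · simp only [hzj, if_false, mul_zero, le_refl]
    calc ∑ j ∈ Finset.range (m + 1), (if blockMapIter L j z ∈ Λ j then a j * (Real.exp (2 * κ * (1 : ℝ)) - 1) * (((L : ℝ) ^ d)⁻¹) ^ j else 0)
        ≤ ∑ j ∈ Finset.range (m + 1), 15 * κ * (if blockMapIter L j z ∈ Λ j then a j * (((L : ℝ) ^ d)⁻¹) ^ j else 0) := Finset.sum_le_sum hterm
      _ = 15 * κ * ∑ j ∈ Finset.range (m + 1), (if blockMapIter L j z ∈ Λ j then a j * (((L : ℝ) ^ d)⁻¹) ^ j else 0) := by rw [Finset.mul_sum]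
      _ ≤ 15 * κ * (A * M z) := mul_le_mul_of_nonneg_left (hA z hz) (by positivity)
      _ = 15 * A * κ * M z := by ring
  have hM := hM0 z hz
  calc 6 * d * (η⁻¹) ^ 2 * (Real.cosh (κ * ((L : ℝ) ^ m)⁻¹) - 1) +
        ∑ j ∈ Finset.range (m + 1), (if blockMapIter L j z ∈ Λ j then a j * (Real.exp (2 * κ * (1 : ℝ)) - 1) * (((L : ℝ) ^ d)⁻¹) ^ j else 0)
      ≤ 6 * d * B * κ * M z + 15 * A * κ * M z := add_le_add hgrad havg
    _ = κ * (6 * d * B + 15 * A) * M z := by ring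
    _ ≤ θ * c₀ * M z := mul_le_mul_of_nonneg_right hκ hM

end Window

/-! ## §4  ★★★ (3.42)₀ for `G′(U₀)` with explicit, `η`-free constants at the coarsest scale -/

section Decay

variable (L : ℕ) (U₀ : Site d → Fin d → 𝔸ˣ) (η : ℝ) (τ : 𝔸 →ₗ[ℂ] ℂ) [FiniteDimensional ℝ 𝔸]
  (hτp : ∀ a : 𝔸, a ≠ 0 → 0 < (τ (star a * a)).re) (m : ℕ) (a : ℕ → ℝ) (Λ : ℕ → Finset (Site d)) (s : Finset (Site d))

/-- ★★★ **[B9] THM 3.1's (3.42), n = 0 SHAPE, FOR THE GENUINE `G′(U₀)` AT THE `ℤᵈ` CARRIER, WITH EXPLICIT MEMBER-UNIFORM CONSTANTS AT THE COARSEST SCALE.**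
`L ≥ 1`; `U₀` unitary with unitary averaged transporters below level `m`; `a ≥ 0`; `0 < d`, `η ≠ 0`; `τ` tracial Hermitian faithful on the finite-dimensional fibre;
DISPLAYED level-weighted coercivity `c₀Σ_{z∈Ω₀}M_z|Φ z|²_τ ≤ ⟨Φ, Ω₀Δ′_a(U₀)Ω₀Φ⟩_τ` (`c₀ > 0`, `M ≥ 0`) and the SCALING inequalities `η⁻²(Lᵐ)⁻² ≤ B·M(z)`,
`Σ_{j≤m}𝟙[yʲ(z)∈Λ_j]a_j(Lᵈ)^{−j} ≤ A·M(z)` on `Ω₀` (`A, B ≥ 0`); `0 ≤ θ < 1`; `0 ≤ κ ≤ 1` with `κ(6dB + 15A) ≤ θc₀` (i.e. `κ ≤ κ₀ = min{1, θc₀∕(6dB + 15A)}`).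
THEN for `y ∈ Ω₀` and every `x` with `M_x, M_y > 0`:  `|(G′(U₀)δ_y w)(x)|_τ ≤ e^{−κL^{−m}|x−y|_∞}·|w|_τ∕((1−θ)c₀·√(M_xM_y))`.
[cite: Balaban1985BackgroundPropagators, Thm 3.1 p.397, (3.42) p.397, (3.24) p.394, Thm 3.11 p.416; Agmon1982, Thm 1.5 p.19] -/
theorem fnorm_GpZd_single_le_exp_coarse [NeZero L] (hd : 0 < d) (hη : η ≠ 0) (hL : 1 ≤ L) (hτt : ∀ a b : 𝔸, τ (a * b) = τ (b * a))
    (hτs : ∀ a : 𝔸, τ (star a) = starRingEnd ℂ (τ a)) (hU : ∀ (x : Site d) (κ : Fin d), U₀ x κ ∈ unitaryUnits 𝔸)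
    (hT : ∀ j', j' < m → ∀ z y : Site d, bgT L U₀ j' z y ∈ unitaryUnits 𝔸) (ha : ∀ j, 0 ≤ a j)
    {c₀ θ : ℝ} (hc₀ : 0 < c₀) (hθ0 : 0 ≤ θ) (hθ1 : θ < 1) {M : Site d → ℝ} (hM0 : ∀ z ∈ s, 0 ≤ M z)
    (hco : ∀ Φ : suppSub (𝔸 := 𝔸) s, c₀ * ∑ z ∈ s, M z * fnorm τ ((Φ : Site d → 𝔸) z) ^ 2 ≤ formE τ s Φ (deltaPrimeADom L U₀ η τ hτp m a Λ s Φ))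
    {A B κ : ℝ} (hκ0 : 0 ≤ κ) (hκ1 : κ ≤ 1) (hκ : κ * (6 * d * B + 15 * A) ≤ θ * c₀)
    (hB : ∀ z ∈ s, (η⁻¹) ^ 2 * (((L : ℝ) ^ m)⁻¹) ^ 2 ≤ B * M z)
    (hA : ∀ z ∈ s, ∑ j ∈ Finset.range (m + 1), (if blockMapIter L j z ∈ Λ j then a j * (((L : ℝ) ^ d)⁻¹) ^ j else 0) ≤ A * M z)
    {y : Site d} (hy : y ∈ s) (w : 𝔸) {x : Site d} (hMx : 0 < M x) (hMy : 0 < M y) :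
    fnorm τ ((GpZd L U₀ η τ hτp m a Λ s hd hη hτt hτs hU ha (restrictSite s (single y w)) : Site d → 𝔸) x) ≤
      Real.exp (-(κ * (((L : ℝ) ^ m)⁻¹ * ((linfDist x y : ℕ) : ℝ)))) / ((1 - θ) * c₀ * Real.sqrt (M x * M y)) * fnorm τ w := by
  classical
  -- the weight data: `ρ = L^{−m}|· − y|_∞`, `ℓ = L^{−m}`, `σ ≡ 1`, references by choice
  set ρ : Site d → ℝ := fun z => ((L : ℝ) ^ m)⁻¹ * ((linfDist z y : ℕ) : ℝ) with hρ
  set rref : ℕ → Site d → ℝ := fun j y' => if h : ∃ x₀ ∈ s, blockMapIter L j x₀ = y' then ρ (Classical.choose h) else 0 with hrref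
  have hlip : ∀ (z : Site d) (μ : Fin d), |ρ (z + e μ) - ρ z| ≤ ((L : ℝ) ^ m)⁻¹ := fun z μ => abs_rho_step_le (d := d) L m hL y z μ
  have hblk : ∀ j ∈ Finset.range (m + 1), ∀ y' ∈ Λ j, ∀ x' ∈ s, blockMapIter L j x' = y' → |ρ x' - rref j y'| ≤ (fun _ : ℕ => (1 : ℝ)) j := by
    intro j hj y' _ x' hx' hxy
    have hex : ∃ x₀ ∈ s, blockMapIter L j x₀ = y' := ⟨x', hx', hxy⟩
    have hr : rref j y' = ρ (Classical.choose hex) := by simp only [hrref, dif_pos hex]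
    rw [hr]
    have hspec := Classical.choose_spec hex
    exact abs_rho_sub_rho_le_of_blockMapIter_eq (d := d) L m hL (by have := Finset.mem_range.1 hj; omega) y (hxy.trans hspec.2.symm)
  have hwin : ∀ z ∈ s, 6 * d * (η⁻¹) ^ 2 * (Real.cosh (κ * ((L : ℝ) ^ m)⁻¹) - 1) +
      ∑ j ∈ Finset.range (m + 1), (if blockMapIter L j z ∈ Λ j then a j * (Real.exp (2 * κ * (fun _ : ℕ => (1 : ℝ)) j) - 1) * (((L : ℝ) ^ d)⁻¹) ^ j else 0)
        ≤ θ * c₀ * M z := fun z hz => window_of_scaling (d := d) hL ha Λ hM0 hκ0 hκ1 hκ hB hA hz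
  have hmain := fnorm_GpZd_single_le_exp_of_levelCoercive L U₀ η τ hτp m a Λ s hd hη hτt hτs hU hT ha hc₀ hθ0 hθ1 hM0 hco hκ0
    (σ := fun _ => (1 : ℝ)) (fun _ => zero_le_one) hlip hblk hwin hy w hMx hMy
  have hρy : ρ y = 0 := by simp [hρ]
  simpa only [hρ, LatticeNorms.linfDist_self, Nat.cast_zero, mul_zero, sub_zero] using hmain

/-- ★★★ **THE AMPLITUDE FLOORED BY THE COARSEST MASS**: with moreover `(ηLᵐ)⁻²∕B ≤ M` at `x` and `y` (`B > 0`; the scaling inequality `hB` read at the two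
sites), `|(G′(U₀)δ_y w)(x)|_τ ≤ (B∕((1−θ)c₀))·(ηLᵐ)²·e^{−κL^{−m}|x−y|_∞}·|w|_τ` — print's `O(1)(Lʲη)²e^{−δ₀d(y,y′)}` at the coarsest scale `j = m` with `O(1) = B∕((1−θ)c₀)`,
`δ₀ = κ`; no constant depends on `η`, `|Ω₀|` or `U₀` beyond the displayed data. [cite: Balaban1985BackgroundPropagators, Thm 3.1 p.397, (3.42) p.397; Agmon1982, Thm 1.5 p.19] -/
theorem fnorm_GpZd_single_le_exp_coarse_amplitude [NeZero L] (hd : 0 < d) (hη : η ≠ 0) (hL : 1 ≤ L) (hτt : ∀ a b : 𝔸, τ (a * b) = τ (b * a))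
    (hτs : ∀ a : 𝔸, τ (star a) = starRingEnd ℂ (τ a)) (hU : ∀ (x : Site d) (κ : Fin d), U₀ x κ ∈ unitaryUnits 𝔸)
    (hT : ∀ j', j' < m → ∀ z y : Site d, bgT L U₀ j' z y ∈ unitaryUnits 𝔸) (ha : ∀ j, 0 ≤ a j)
    {c₀ θ : ℝ} (hc₀ : 0 < c₀) (hθ0 : 0 ≤ θ) (hθ1 : θ < 1) {M : Site d → ℝ} (hM0 : ∀ z ∈ s, 0 ≤ M z)
    (hco : ∀ Φ : suppSub (𝔸 := 𝔸) s, c₀ * ∑ z ∈ s, M z * fnorm τ ((Φ : Site d → 𝔸) z) ^ 2 ≤ formE τ s Φ (deltaPrimeADom L U₀ η τ hτp m a Λ s Φ))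
    {A B κ : ℝ} (hBpos : 0 < B) (hκ0 : 0 ≤ κ) (hκ1 : κ ≤ 1) (hκ : κ * (6 * d * B + 15 * A) ≤ θ * c₀)
    (hB : ∀ z ∈ s, (η⁻¹) ^ 2 * (((L : ℝ) ^ m)⁻¹) ^ 2 ≤ B * M z)
    (hA : ∀ z ∈ s, ∑ j ∈ Finset.range (m + 1), (if blockMapIter L j z ∈ Λ j then a j * (((L : ℝ) ^ d)⁻¹) ^ j else 0) ≤ A * M z)
    {y : Site d} (hy : y ∈ s) (w : 𝔸) {x : Site d} (hx : x ∈ s) :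
    fnorm τ ((GpZd L U₀ η τ hτp m a Λ s hd hη hτt hτs hU ha (restrictSite s (single y w)) : Site d → 𝔸) x) ≤
      B / ((1 - θ) * c₀) * (η * (L : ℝ) ^ m) ^ 2 * Real.exp (-(κ * (((L : ℝ) ^ m)⁻¹ * ((linfDist x y : ℕ) : ℝ)))) * fnorm τ w := by
  have hL0 : (0 : ℝ) < L := by exact_mod_cast hL
  -- the mass floor `μ₀ := η⁻²(Lᵐ)⁻²∕B ≤ M` at `x` and `y`
  set μ₀ : ℝ := (η⁻¹) ^ 2 * (((L : ℝ) ^ m)⁻¹) ^ 2 / B with hμ₀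
  have hμ₀pos : 0 < μ₀ := by
    have : 0 < (η⁻¹) ^ 2 := by positivity
    positivity
  have hfloor : ∀ z ∈ s, μ₀ ≤ M z := fun z hz => by
    rw [hμ₀, div_le_iff₀ hBpos]; linarith [hB z hz]
  have hMx : 0 < M x := hμ₀pos.trans_le (hfloor x hx)
  have hMy : 0 < M y := hμ₀pos.trans_le (hfloor y hy)
  have hmain := fnorm_GpZd_single_le_exp_coarse L U₀ η τ hτp m a Λ s hd hη hL hτt hτs hU hT ha hc₀ hθ0 hθ1 hM0 hco hκ0 hκ1 hκ hB hA hy w hMx hMy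
  refine hmain.trans ?_
  have hθ' : 0 < 1 - θ := by linarith
  have hE : 0 < Real.exp (-(κ * (((L : ℝ) ^ m)⁻¹ * ((linfDist x y : ℕ) : ℝ)))) := Real.exp_pos _
  have hw0 := fnorm_nonneg τ w
  -- `√(M_xM_y) ≥ μ₀` and `1∕μ₀ = B(ηLᵐ)²`
  have hsqrt : μ₀ ≤ Real.sqrt (M x * M y) := by
    rw [Real.le_sqrt hμ₀pos.le (mul_pos hMx hMy).le, sq]
    exact mul_le_mul (hfloor x hx) (hfloor y hy) hμ₀pos.le hMx.le
  have hinv : 1 / ((1 - θ) * c₀ * Real.sqrt (M x * M y)) ≤ 1 / ((1 - θ) * c₀ * μ₀) := by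
    apply one_div_le_one_div_of_le (by positivity)
    exact mul_le_mul_of_nonneg_left hsqrt (by positivity)
  have hμ₀inv : 1 / ((1 - θ) * c₀ * μ₀) = B / ((1 - θ) * c₀) * (η * (L : ℝ) ^ m) ^ 2 := by
    rw [hμ₀]
    field_simp
  calc Real.exp (-(κ * (((L : ℝ) ^ m)⁻¹ * ((linfDist x y : ℕ) : ℝ)))) / ((1 - θ) * c₀ * Real.sqrt (M x * M y)) * fnorm τ w
      = (1 / ((1 - θ) * c₀ * Real.sqrt (M x * M y))) * Real.exp (-(κ * (((L : ℝ) ^ m)⁻¹ * ((linfDist x y : ℕ) : ℝ)))) * fnorm τ w := by ring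
    _ ≤ (1 / ((1 - θ) * c₀ * μ₀)) * Real.exp (-(κ * (((L : ℝ) ^ m)⁻¹ * ((linfDist x y : ℕ) : ℝ)))) * fnorm τ w := by gcongr
    _ = B / ((1 - θ) * c₀) * (η * (L : ℝ) ^ m) ^ 2 * Real.exp (-(κ * (((L : ℝ) ^ m)⁻¹ * ((linfDist x y : ℕ) : ℝ)))) * fnorm τ w := by rw [hμ₀inv]

end Decay

/-! ## §5  Non-vacuity (A6): at a cube member, EVERY unitary background — no displayed coercivity left -/

section CubeMember

variable (L : ℕ) (τ : 𝔸 →ₗ[ℂ] ℂ) [FiniteDimensional ℝ 𝔸] (hτp : ∀ a : 𝔸, a ≠ 0 → 0 < (τ (star a * a)).re)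

/-- ★★ **AT A CUBE MEMBER OF [B8] (1.131), FOR EVERY UNITARY BACKGROUND — THE DISPLAYED COERCIVITY DISCHARGED (A6).**  With n06-w4 g4's member-uniform Friedrichs
constant `(M_c + 4ρ)⁻²` (`formE_deltaPrimeADom_coercive_cubeMember_uniform`, `η·Lᵏ ≤ 1`, flat mass `M ≡ 1`), the coarse-scale bound holds with `c₀ = (M_c + 4ρ)⁻²`,
`B = η⁻²L^{−2m}`, `A = Σ_{j≤m}a_j(Lᵈ)^{−j}`: for `0 ≤ κ ≤ 1` with `κ·(6dη⁻²L^{−2m} + 15Σ_{j≤m}a_j(Lᵈ)^{−j}) ≤ θ(M_c + 4ρ)⁻²`,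
`|(G′(U₀)δ_y w)(x)|_τ ≤ e^{−κL^{−m}|x−y|_∞}·|w|_τ∕((1−θ)(M_c + 4ρ)⁻²)` on `□₀`.  HONEST: uniform in `η` exactly when `η⁻²L^{−2m}` and the member's penalty scales
`a_j(Lᵈ)^{−j}` are bounded (single top level `m = k`, `ηLᵏ = 1`); for print's multi-level weights `a_j(Lʲη)^{d−2}` the flat mass does NOT dominate the finer shells
— that needs the LEVEL-WEIGHTED `hco` of §4 (displayed there).
[cite: Balaban1985BackgroundPropagators, Thm 3.1 p.397, (3.42) p.397, Thm 3.11 p.416; Balaban1985RegularSpaces, (1.131) p.99; Balaban1984PropagatorsII, p.226] -/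
theorem fnorm_GpZd_single_le_exp_coarse_cubeMember [Nontrivial 𝔸] (hd : 0 < d) (hL : 2 ≤ L) (hτt : ∀ a b : 𝔸, τ (a * b) = τ (b * a))
    (hτs : ∀ a : 𝔸, τ (star a) = starRingEnd ℂ (τ a)) (i : ZdIdx d L) {ac : Site d} {Mc ρc : ℕ} (hΩ : i.Ω = cubeFam false L ac Mc ρc i.k)
    (hρc : 1 ≤ ρc) (hηk : i.η * (L : ℝ) ^ i.k ≤ 1) (m : ℕ) {a : ℕ → ℝ} (ha : ∀ j, 0 ≤ a j) (Λ : ℕ → Finset (Site d))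
    {U₀ : Site d → Fin d → 𝔸ˣ} (hU : ∀ (x : Site d) (κ : Fin d), U₀ x κ ∈ unitaryUnits 𝔸)
    (hT : ∀ j', j' < m → ∀ z y : Site d, bgT L U₀ j' z y ∈ unitaryUnits 𝔸)
    {θ κ : ℝ} (hθ0 : 0 ≤ θ) (hθ1 : θ < 1) (hκ0 : 0 ≤ κ) (hκ1 : κ ≤ 1)
    (hκ : κ * (6 * d * ((i.η⁻¹) ^ 2 * (((L : ℝ) ^ m)⁻¹) ^ 2) + 15 * ∑ j ∈ Finset.range (m + 1), a j * (((L : ℝ) ^ d)⁻¹) ^ j) ≤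
      θ * (((Mc : ℝ) + 4 * ρc) ^ 2)⁻¹)
    {y : Site d} (hy : y ∈ (cubeMember_Ω0_finite i hΩ).toFinset) (w : 𝔸) (x : Site d) :
    fnorm τ ((GpZd L U₀ i.η τ hτp m a Λ (cubeMember_Ω0_finite i hΩ).toFinset hd i.hη.ne' hτt hτs hU ha
        (restrictSite (cubeMember_Ω0_finite i hΩ).toFinset (single y w)) : Site d → 𝔸) x) ≤
      Real.exp (-(κ * (((L : ℝ) ^ m)⁻¹ * ((linfDist x y : ℕ) : ℝ)))) / ((1 - θ) * (((Mc : ℝ) + 4 * ρc) ^ 2)⁻¹) * fnorm τ w := by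
  haveI : NeZero L := ⟨by omega⟩
  set S := (cubeMember_Ω0_finite i hΩ).toFinset with hS
  have hc₀ : 0 < (((Mc : ℝ) + 4 * ρc) ^ 2)⁻¹ := by
    have hρ1 : (1 : ℝ) ≤ ρc := by exact_mod_cast hρc
    have : (0 : ℝ) < (Mc : ℝ) + 4 * ρc := by positivity
    positivity
  -- the flat-mass coercivity `M ≡ 1`
  have hco : ∀ Φ : suppSub (𝔸 := 𝔸) S, (((Mc : ℝ) + 4 * ρc) ^ 2)⁻¹ * ∑ z ∈ S, (fun _ : Site d => (1 : ℝ)) z * fnorm τ ((Φ : Site d → 𝔸) z) ^ 2 ≤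
      formE τ S Φ (deltaPrimeADom L U₀ i.η τ hτp m a Λ S Φ) := by
    intro Φ
    have h := formE_deltaPrimeADom_coercive_cubeMember_uniform τ hτp hτt hτs hd hL i hΩ hρc hηk m ha Λ hU Φ
    simpa only [one_mul, ← formE_self_eq_sum_sq hτp] using h
  have hmain := fnorm_GpZd_single_le_exp_coarse L U₀ i.η τ hτp m a Λ S hd i.hη.ne' (le_trans one_le_two hL) hτt hτs hU hT ha hc₀ hθ0 hθ1
    (M := fun _ => (1 : ℝ)) (fun _ _ => zero_le_one) hco (A := ∑ j ∈ Finset.range (m + 1), a j * (((L : ℝ) ^ d)⁻¹) ^ j)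
    (B := (i.η⁻¹) ^ 2 * (((L : ℝ) ^ m)⁻¹) ^ 2) hκ0 hκ1 (by simpa only [mul_comm] using hκ) (fun z _ => by simp)
    (fun z _ => by
      rw [mul_one]
      refine Finset.sum_le_sum fun j _ => ?_
      by_cases hzj : blockMapIter L j z ∈ Λ j
      · simp only [hzj, if_true, le_refl]
      · simp only [hzj, if_false]; exact mul_nonneg (ha j) (by positivity))
    hy w (x := x) one_pos one_pos
  simpa only [mul_one, Real.sqrt_one] using hmain

end CubeMember

end Literature.MathematicalPhysics.QuantumFieldTheory.Balaban1983to89.B9Thm31GpAgmonDecayCoarseZd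

end
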